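import Mathlib
import HarnessLib
import Summits.MatrixMultiplication.MatrixMultiplication.Theorems.OutsiderSandwichToricCeilingPowMixedSubTwo
import Summits.MatrixMultiplication.MatrixMultiplication.Theorems.OutsiderSandwichToricCeilingPowTwoCwStar
import Summits.MatrixMultiplication.MatrixMultiplication.Theorems.OutsiderSandwichToricCeilingPowTwoCwCrossed
import Summits.MatrixMultiplication.MatrixMultiplication.Theorems.OutsiderSandwichToricCeilingPowTwoCwSpread

/-!
# OutsiderSandwich — no toric `⟨3^N - 2⟩` in product frames of `cw₂^{⊠N}` with at most TWO cw
coordinates, every `N ≥ 4`, modulo the `N = 3` two-cw existence census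
(decomp-mm lens 4, gen 47, kernel K47-4; THESES-FREE, `ω`-free; helper toward `LaserTangency`,
stmt-32268 — the extremal subrank/packing cells of the literal host `kroneckerPow (cwTensor ℂ 2) N`)

LABEL.  TORIC · uniform in `N ≥ 4` · NEC-side instrument of the decomposition cell, CONDITIONAL on
one finite `N = 3` statement (`hB₃'` below: DATA, not kernel — NODE-g46 §3 / NODE-g47 §3 of
decomp-mm lens 4: all `3 × 7 004` canonical lawful co-size-2 complements of the frames `ccD`, `cDc`,
`Dcc` carry two perfect matchings).  The rates / the crux `h₁ = LaserTangency` and the route's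
`closes` are untouched.

WHAT.  `productFrame_atMostTwoCw_no_diagonal_comb_degeneration_sub_two`: in the product frame
`frame κ ⊂ (Fin N → Fin 3)³` of `cw₂^{⊠N}` in ANY product basis `κ` with at most two
Coppersmith–Winograd coordinates and `N ≥ 4`, no diagonal `Ψ` with `#Ψ ≥ 3^N - 2` is a
combinatorial degeneration (weights `a, b, c` vanishing on `Ψ` and `≥ 1` on the other frame
triples) — GIVEN `hB₃'`: every lawful co-size-2 complement of a product frame over `Word 3` with
EXACTLY two cw coordinates has a perfect matching.  At most one cw coordinate is K46-9
(`…PowMixedSubTwo`, unconditional, `N ≥ 3`); the new case is exactly two.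

HOW (the K46 machine, one storey up).  Pivot at a PERMUTATION coordinate (with ≤ 2 cw coordinates
and `N ≥ 4` there are ≥ 2 of them, so a permutation TAIL coordinate `j₀` for the flags exists as
well): PURE slice `…PowMixedPure.twoPMκ_pure` (unchanged — it uses no star), CROSSED and SPREAD
slices in the star-hypothesis form `…PowTwoCwCrossed.twoPMκ_crossedX`,
`…PowTwoCwSpread.twoPMκ_spread` fed with the two-cw star lemma `…PowTwoCwStar.hasPM_star_two`;
the induction on `N` carries EXISTENCE of a perfect matching for every lawful co-size-2 complement
(from `N = 3`: hypothesis) and yields TWO distinct ones from `N = 4` on (`hasPMκ_twoPMκ₂`); the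
missing words of a size-`3^N - 2` diagonal are lawful (`…ToricComplement`) and two matchings on the
same vertex sets exclude a degeneration (`…ToricUniqueness`), exactly as in K46-8.
WHY `N = 3` IS A HYPOTHESIS AND NOT A SLICE (NODE-g47 §3): at `N = 3` with two cw coordinates the
only permutation coordinate is the pivot, so there is no permutation tail coordinate for the flags,
and the co-size-2 TAIL instances live in `cw ⊠ cw`, where `156` of the `1 440` lawful ones have no
perfect matching (`…PowLawNoMatching.cwcw_lawful_unmatchable`); e.g. the lawful `Dcc` complement
`X = {012, 021}, Y = {100, 111}, Z = {201, 210}` has no matching inside the parallel class of its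
pivot slot although it has more than `3·10⁵` perfect matchings (DATA).  A kernel census of the
`N = 3` two-cw base is ≈ `10⁴` instances of `25` rows after symmetry reduction — out of scale for one
`decide` (NODE-g47 §4); hence the explicit hypothesis, in the style of K46-8's `hB`.
No new definitions; no new axioms.
-/

set_option linter.dupNamespace false

namespace Summit.MatrixMultiplication.MatrixMultiplication.Theorems.OutsiderSandwichToricCeilingPowTwoCw

open Finset
open Summit.MatrixMultiplication.MatrixMultiplication.Theorems.OutsiderSandwichToricCeilingPowFibres
  (Word Tr3 slotB frame)
open Summit.MatrixMultiplication.MatrixMultiplication.Theorems.OutsiderSandwichToricCeilingPowSubTwoGlue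
open Summit.MatrixMultiplication.MatrixMultiplication.Theorems.OutsiderSandwichToricCeilingPowSubTwoRules
open Summit.MatrixMultiplication.MatrixMultiplication.Theorems.OutsiderSandwichToricCeilingPowMixedGlue
open Summit.MatrixMultiplication.MatrixMultiplication.Theorems.OutsiderSandwichToricCeilingPowMixedRules
open Summit.MatrixMultiplication.MatrixMultiplication.Theorems.OutsiderSandwichToricCeilingPowMixedPure
  (twoPMκ_pure)
open Summit.MatrixMultiplication.MatrixMultiplication.Theorems.OutsiderSandwichToricCeilingPowTwoCwCrossed
  (twoPMκ_crossedX)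
open Summit.MatrixMultiplication.MatrixMultiplication.Theorems.OutsiderSandwichToricCeilingPowTwoCwSpread
  (twoPMκ_spread)
open Summit.MatrixMultiplication.MatrixMultiplication.Theorems.OutsiderSandwichToricCeilingPowTwoCwStar
  (hasPM_star_two tailκ_atMostTwo)
open Summit.MatrixMultiplication.MatrixMultiplication.Theorems.OutsiderSandwichToricCeilingPowMixed
  (exists_tail_true twoPMκ_rot hasPMκ_twoPMκ)
open Summit.MatrixMultiplication.MatrixMultiplication.Theorems.OutsiderSandwichToricCeilingPowMixedBase
  (mixedBaseTwo)
open Summit.MatrixMultiplication.MatrixMultiplication.Theorems.OutsiderSandwichToricCeilingPow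
  (productFrame_no_diagonal_comb_degeneration)
open Summit.MatrixMultiplication.MatrixMultiplication.Theorems.OutsiderSandwichToricUniqueness
  (no_comb_degeneration_of_two_matchings)
open Summit.MatrixMultiplication.MatrixMultiplication.Theorems.OutsiderSandwichToricComplement
  (image_eq_sdiff_pair two_missing_letters_dcoord two_missing_letters_cwcoord)
open Summit.MatrixMultiplication.MatrixMultiplication.Theorems.OutsiderSandwichToricCeilingPowSubTwo
  (tightFrame_pow_no_diagonal_comb_degeneration_sub_two)

variable {m n : ℕ}

/-! ## §1 Coordinates of an at-most-two-cw basis -/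

/-- Of three pairwise distinct coordinates of an at-most-two-cw basis, one is a permutation
coordinate. -/
theorem false_of_three {κ : Fin n → Bool}
    (hκ : ∀ i j k, κ i = true → κ j = true → κ k = true → i = j ∨ j = k ∨ i = k) {i j k : Fin n}
    (hij : i ≠ j) (hjk : j ≠ k) (hik : i ≠ k) : κ i = false ∨ κ j = false ∨ κ k = false := by
  by_contra h
  simp only [not_or, Bool.not_eq_false] at h
  rcases hκ i j k h.1 h.2.1 h.2.2 with e | e | e
  exacts [hij e, hjk e, hik e]

/-- A permutation TAIL coordinate exists (`m ≥ 3` tail coordinates, at most two of them cw). -/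
theorem exists_tail_false₂ {p : Fin (m + 1)} {κ : Fin (m + 1) → Bool}
    (hκ : ∀ i j k, κ i = true → κ j = true → κ k = true → i = j ∨ j = k ∨ i = k) (hm : 3 ≤ m) :
    ∃ j₀ : Fin m, κ (p.succAbove j₀) = false := by
  have hκ' := tailκ_atMostTwo (p := p) hκ
  have h01 : (⟨0, by omega⟩ : Fin m) ≠ ⟨1, by omega⟩ := by simp [Fin.ext_iff]
  have h12 : (⟨1, by omega⟩ : Fin m) ≠ ⟨2, by omega⟩ := by simp [Fin.ext_iff]
  have h02 : (⟨0, by omega⟩ : Fin m) ≠ ⟨2, by omega⟩ := by simp [Fin.ext_iff]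
  rcases false_of_three hκ' h01 h12 h02 with h | h | h
  · exact ⟨_, (tailκ_apply p κ _).symm.trans h⟩
  · exact ⟨_, (tailκ_apply p κ _).symm.trans h⟩
  · exact ⟨_, (tailκ_apply p κ _).symm.trans h⟩

/-- A permutation coordinate exists (`m + 1 ≥ 3` coordinates, at most two of them cw). -/
theorem exists_coord_false₂ {κ : Fin (m + 1) → Bool}
    (hκ : ∀ i j k, κ i = true → κ j = true → κ k = true → i = j ∨ j = k ∨ i = k) (hm : 2 ≤ m) :
    ∃ p, κ p = false := by
  have h01 : (⟨0, by omega⟩ : Fin (m + 1)) ≠ ⟨1, by omega⟩ := by simp [Fin.ext_iff]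
  have h12 : (⟨1, by omega⟩ : Fin (m + 1)) ≠ ⟨2, by omega⟩ := by simp [Fin.ext_iff]
  have h02 : (⟨0, by omega⟩ : Fin (m + 1)) ≠ ⟨2, by omega⟩ := by simp [Fin.ext_iff]
  rcases false_of_three hκ h01 h12 h02 with h | h | h
  exacts [⟨_, h⟩, ⟨_, h⟩, ⟨_, h⟩]

/-! ## §2 The induction step and the main lemma -/

/-- THE INDUCTION STEP: two distinct perfect matchings of every lawful co-size-2 complement of an
at-most-two-cw product frame over `Word (m+1)`, `m ≥ 3`, given EXISTENCE at level `m`.  Pivot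
rule as in K46-8: a PERMUTATION coordinate with a doubled pair if there is one (PURE / CROSSED, up
to rotating the roles of `x, y, z`), else SPREAD at any permutation coordinate; the stars of the
CROSSED and SPREAD slices come from the two-cw star lemma. -/
theorem twoPMκ_step₂
    (IH : ∀ κ : Fin m → Bool,
      (∀ i j k, κ i = true → κ j = true → κ k = true → i = j ∨ j = k ∨ i = k) → (∃ i, κ i = true) →
      ∀ x₁ x₂ y₁ y₂ z₁ z₂ : Word m, x₁ ≠ x₂ → y₁ ≠ y₂ → z₁ ≠ z₂ →
      (∀ i, lawκ (κ i) (x₁ i) (x₂ i) (y₁ i) (y₂ i) (z₁ i) (z₂ i) = true) →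
      ∃ P, isPMκ κ P {x₁, x₂} {y₁, y₂} {z₁, z₂} = true)
    (hm : 3 ≤ m) {κ : Fin (m + 1) → Bool}
    (hκ : ∀ i j k, κ i = true → κ j = true → κ k = true → i = j ∨ j = k ∨ i = k)
    (hcw : ∃ i, κ i = true) {x₁ x₂ y₁ y₂ z₁ z₂ : Word (m + 1)} (hx : x₁ ≠ x₂) (hy : y₁ ≠ y₂)
    (hz : z₁ ≠ z₂)
    (hadm : ∀ i, lawκ (κ i) (x₁ i) (x₂ i) (y₁ i) (y₂ i) (z₁ i) (z₂ i) = true) :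
    ∃ P₁ P₂, P₁ ≠ P₂ ∧ isPMκ κ P₁ {x₁, x₂} {y₁, y₂} {z₁, z₂} = true ∧
      isPMκ κ P₂ {x₁, x₂} {y₁, y₂} {z₁, z₂} = true := by
  have ih : ∀ {p : Fin (m + 1)}, κ p = false → ∀ x₁ x₂ y₁ y₂ z₁ z₂ : Word m, x₁ ≠ x₂ → y₁ ≠ y₂ →
      z₁ ≠ z₂ → (∀ j, lawκ (tailκ p κ j) (x₁ j) (x₂ j) (y₁ j) (y₂ j) (z₁ j) (z₂ j) = true) →
      ∃ P, isPMκ (tailκ p κ) P {x₁, x₂} {y₁, y₂} {z₁, z₂} = true :=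
    fun hp => IH _ (tailκ_atMostTwo hκ) (exists_tail_true hp hcw)
  have hst : ∀ {p : Fin (m + 1)}, ∀ x y z : Word m, (∀ j, x j ≠ y j ∧ y j ≠ z j ∧ x j ≠ z j) →
      ∃ P, isPMκ (tailκ p κ) P {x} {y} {z} = true :=
    fun {p} => hasPM_star_two m (tailκ p κ) (tailκ_atMostTwo hκ)
  by_cases hD : ∃ p, κ p = false ∧ (x₁ p = x₂ p ∨ y₁ p = y₂ p ∨ z₁ p = z₂ p)
  · obtain ⟨p, hp, hdbl⟩ := hD
    obtain ⟨j₀, hj₀⟩ := exists_tail_false₂ (p := p) hκ hm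
    obtain ⟨j₁, hj₁⟩ := exists_tail_true hp hcw
    by_cases hxp : x₁ p = x₂ p
    · by_cases hyp : y₁ p = y₂ p
      · exact twoPMκ_pure hp (ih hp) j₀ hj₀ j₁ hj₁ hx hy hz hadm hxp hyp
      · exact twoPMκ_crossedX hp hst (ih hp) j₀ hj₀ hx hadm hxp hyp
    by_cases hyp : y₁ p = y₂ p
    · have hadm' : ∀ i, lawκ (κ i) (y₁ i) (y₂ i) (z₁ i) (z₂ i) (x₁ i) (x₂ i) = true :=
        fun i => lawκ_rot _ _ _ _ _ _ _ (hadm i)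
      have two : ∃ P₁ P₂, P₁ ≠ P₂ ∧ isPMκ κ P₁ {y₁, y₂} {z₁, z₂} {x₁, x₂} = true ∧
          isPMκ κ P₂ {y₁, y₂} {z₁, z₂} {x₁, x₂} = true := by
        by_cases hzp : z₁ p = z₂ p
        · exact twoPMκ_pure hp (ih hp) j₀ hj₀ j₁ hj₁ hy hz hx hadm' hyp hzp
        · exact twoPMκ_crossedX hp hst (ih hp) j₀ hj₀ hy hadm' hyp hzp
      exact twoPMκ_rot (twoPMκ_rot two)
    have hzp : z₁ p = z₂ p := by
      rcases hdbl with h | h | h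
      exacts [absurd h hxp, absurd h hyp, h]
    have hadm' : ∀ i, lawκ (κ i) (z₁ i) (z₂ i) (x₁ i) (x₂ i) (y₁ i) (y₂ i) = true :=
      fun i => lawκ_rot _ _ _ _ _ _ _ (lawκ_rot _ _ _ _ _ _ _ (hadm i))
    exact twoPMκ_rot (twoPMκ_crossedX hp hst (ih hp) j₀ hj₀ hz hadm' hzp hxp)
  · push Not at hD
    obtain ⟨p, hp⟩ := exists_coord_false₂ hκ (by omega)
    obtain ⟨j₀, hj₀⟩ := exists_tail_false₂ (p := p) hκ hm
    exact twoPMκ_spread hp hst (ih hp) j₀ hj₀ hadm hD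

/-- MAIN LEMMA (all `m ≥ 3`, resp. `m ≥ 4`; `hB₃` = the `N = 3` existence statement for every
at-most-two-cw basis with a cw coordinate): every lawful co-size-2 complement of an at-most-two-cw
product frame over `Word m` with a cw coordinate has a perfect matching, and for `m ≥ 4` two
distinct ones. -/
theorem hasPMκ_twoPMκ₂
    (hB₃ : ∀ κ : Fin 3 → Bool,
      (∀ i j k, κ i = true → κ j = true → κ k = true → i = j ∨ j = k ∨ i = k) → (∃ i, κ i = true) →
      ∀ x₁ x₂ y₁ y₂ z₁ z₂ : Word 3, x₁ ≠ x₂ → y₁ ≠ y₂ → z₁ ≠ z₂ →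
      (∀ i, lawκ (κ i) (x₁ i) (x₂ i) (y₁ i) (y₂ i) (z₁ i) (z₂ i) = true) →
      ∃ P, isPMκ κ P {x₁, x₂} {y₁, y₂} {z₁, z₂} = true) :
    ∀ m, 3 ≤ m →
    (∀ κ : Fin m → Bool,
      (∀ i j k, κ i = true → κ j = true → κ k = true → i = j ∨ j = k ∨ i = k) → (∃ i, κ i = true) →
      ∀ x₁ x₂ y₁ y₂ z₁ z₂ : Word m, x₁ ≠ x₂ → y₁ ≠ y₂ → z₁ ≠ z₂ →
      (∀ i, lawκ (κ i) (x₁ i) (x₂ i) (y₁ i) (y₂ i) (z₁ i) (z₂ i) = true) →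
      ∃ P, isPMκ κ P {x₁, x₂} {y₁, y₂} {z₁, z₂} = true) ∧
    (4 ≤ m → ∀ κ : Fin m → Bool,
      (∀ i j k, κ i = true → κ j = true → κ k = true → i = j ∨ j = k ∨ i = k) → (∃ i, κ i = true) →
      ∀ x₁ x₂ y₁ y₂ z₁ z₂ : Word m, x₁ ≠ x₂ → y₁ ≠ y₂ → z₁ ≠ z₂ →
      (∀ i, lawκ (κ i) (x₁ i) (x₂ i) (y₁ i) (y₂ i) (z₁ i) (z₂ i) = true) →
      ∃ P₁ P₂, P₁ ≠ P₂ ∧ isPMκ κ P₁ {x₁, x₂} {y₁, y₂} {z₁, z₂} = true ∧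
        isPMκ κ P₂ {x₁, x₂} {y₁, y₂} {z₁, z₂} = true) := by
  intro m hm
  induction m, hm using Nat.le_induction with
  | base => exact ⟨hB₃, fun h => absurd h (by norm_num)⟩
  | succ m hm IH =>
    refine ⟨fun κ hκ hcw x₁ x₂ y₁ y₂ z₁ z₂ hx hy hz hadm => ?_,
      fun _ κ hκ hcw x₁ x₂ y₁ y₂ z₁ z₂ hx hy hz hadm => twoPMκ_step₂ IH.1 hm hκ hcw hx hy hz hadm⟩
    obtain ⟨P₁, -, -, h₁, -⟩ := twoPMκ_step₂ IH.1 hm hκ hcw hx hy hz hadm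
    exact ⟨P₁, h₁⟩

/-- The `N = 3` hypothesis reduces to the frames with EXACTLY two cw coordinates (`ccD`, `cDc`,
`Dcc`): with at most one cw coordinate, existence at `N = 3` is K46-8/K46-7
(`…PowMixed.hasPMκ_twoPMκ` with the kernel census `…PowMixedBase.mixedBaseTwo`). -/
theorem base₃_of_twoCw
    (hB₃' : ∀ κ : Fin 3 → Bool,
      (∀ i j k, κ i = true → κ j = true → κ k = true → i = j ∨ j = k ∨ i = k) →
      (∃ i j, i ≠ j ∧ κ i = true ∧ κ j = true) →
      ∀ x₁ x₂ y₁ y₂ z₁ z₂ : Word 3, x₁ ≠ x₂ → y₁ ≠ y₂ → z₁ ≠ z₂ →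
      (∀ i, lawκ (κ i) (x₁ i) (x₂ i) (y₁ i) (y₂ i) (z₁ i) (z₂ i) = true) →
      ∃ P, isPMκ κ P {x₁, x₂} {y₁, y₂} {z₁, z₂} = true) :
    ∀ κ : Fin 3 → Bool,
      (∀ i j k, κ i = true → κ j = true → κ k = true → i = j ∨ j = k ∨ i = k) → (∃ i, κ i = true) →
      ∀ x₁ x₂ y₁ y₂ z₁ z₂ : Word 3, x₁ ≠ x₂ → y₁ ≠ y₂ → z₁ ≠ z₂ →
      (∀ i, lawκ (κ i) (x₁ i) (x₂ i) (y₁ i) (y₂ i) (z₁ i) (z₂ i) = true) →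
      ∃ P, isPMκ κ P {x₁, x₂} {y₁, y₂} {z₁, z₂} = true := by
  intro κ hκ hcw x₁ x₂ y₁ y₂ z₁ z₂ hx hy hz hadm
  by_cases h2 : ∃ i j, i ≠ j ∧ κ i = true ∧ κ j = true
  · exact hB₃' κ hκ h2 x₁ x₂ y₁ y₂ z₁ z₂ hx hy hz hadm
  · have hκ₁ : ∀ i j, κ i = true → κ j = true → i = j := fun i j hi hj => by
      by_contra hij; exact h2 ⟨i, j, hij, hi, hj⟩
    exact (hasPMκ_twoPMκ mixedBaseTwo 3 (by norm_num)).1 κ hκ₁ hcw x₁ x₂ y₁ y₂ z₁ z₂ hx hy hz hadm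

/-! ## §3 The theorem -/

/-- **Toric ceiling `⟨3^N - 2⟩` in product frames with AT MOST TWO cw coordinates, all `N ≥ 4`
(modulo the `N = 3` two-cw existence census `hB₃'`).**  In the product frame `frame κ` of
`cw₂^{⊠N}` in a product basis with at most two Coppersmith–Winograd coordinates, no diagonal-free
`Ψ` with `#Ψ ≥ 3^N - 2` is a combinatorial degeneration: no cw coordinate is the tight frame
(K45, `…PowSubTwo`); otherwise `#Ψ ≥ 3^N - 1` is `…ToricCeilingPow`, and for `#Ψ = 3^N - 2` the
six missing words are lawful at every coordinate (`…ToricComplement`), the complement carries two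
distinct perfect matchings (`hasPMκ_twoPMκ₂`), and two perfect matchings on the same vertex sets
exclude a degeneration (`…ToricUniqueness`).
[TORIC · uniform in N ≥ 4 · NEC-side instrument; CONDITIONAL on the finite N = 3 two-cw existence
statement `hB₃'` (DATA: every lawful co-size-2 complement of `ccD`, `cDc`, `Dcc` has ≥ 2 perfect
matchings); the rates of `h₁ = LaserTangency` untouched] -/
theorem productFrame_atMostTwoCw_no_diagonal_comb_degeneration_sub_two {R : Type*} [CommRing R]
    [LinearOrder R] [IsStrictOrderedRing R]
    (hB₃' : ∀ κ : Fin 3 → Bool,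
      (∀ i j k, κ i = true → κ j = true → κ k = true → i = j ∨ j = k ∨ i = k) →
      (∃ i j, i ≠ j ∧ κ i = true ∧ κ j = true) →
      ∀ x₁ x₂ y₁ y₂ z₁ z₂ : Word 3, x₁ ≠ x₂ → y₁ ≠ y₂ → z₁ ≠ z₂ →
      (∀ i, lawκ (κ i) (x₁ i) (x₂ i) (y₁ i) (y₂ i) (z₁ i) (z₂ i) = true) →
      ∃ P, isPMκ κ P {x₁, x₂} {y₁, y₂} {z₁, z₂} = true)
    {N : ℕ} (hN : 4 ≤ N) (κ : Fin N → Bool)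
    (hκ : ∀ i j k, κ i = true → κ j = true → κ k = true → i = j ∨ j = k ∨ i = k)
    {Ψ : Finset (Tr3 N)} {a b c : Word N → R} (hsub : Ψ ⊆ frame κ)
    (hzero : ∀ t ∈ Ψ, a t.1 + b t.2.1 + c t.2.2 = 0)
    (hone : ∀ t ∈ frame κ, t ∉ Ψ → 1 ≤ a t.1 + b t.2.1 + c t.2.2)
    (hdiag : ∀ t ∈ Ψ, ∀ t' ∈ Ψ, (t.1 = t'.1 ∨ t.2.1 = t'.2.1 ∨ t.2.2 = t'.2.2) → t = t')
    (hbig : 3 ^ N ≤ #Ψ + 2) : False := by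
  by_cases hcw : ∃ i, κ i = true
  swap
  · obtain rfl : κ = fun _ => false := funext fun i => by simpa using fun h => hcw ⟨i, h⟩
    exact tightFrame_pow_no_diagonal_comb_degeneration_sub_two (by omega) hsub hzero hone hdiag hbig
  by_cases h1 : 3 ^ N ≤ #Ψ + 1
  · exact productFrame_no_diagonal_comb_degeneration (by omega) κ hsub hzero hone hdiag h1
  have hcard : #Ψ + 2 = 3 ^ N := by omega
  have jΨ₁ : Set.InjOn (fun t : Tr3 N => t.1) Ψ := fun t ht t' ht' e => hdiag t ht t' ht' (Or.inl e)
  have jΨ₂ : Set.InjOn (fun t : Tr3 N => t.2.1) Ψ :=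
    fun t ht t' ht' e => hdiag t ht t' ht' (Or.inr (Or.inl e))
  have jΨ₃ : Set.InjOn (fun t : Tr3 N => t.2.2) Ψ :=
    fun t ht t' ht' e => hdiag t ht t' ht' (Or.inr (Or.inr e))
  obtain ⟨x₁, x₂, hx, hX⟩ := image_eq_sdiff_pair jΨ₁ hcard
  obtain ⟨y₁, y₂, hy, hY⟩ := image_eq_sdiff_pair jΨ₂ hcard
  obtain ⟨z₁, z₂, hz, hZ⟩ := image_eq_sdiff_pair jΨ₃ hcard
  have hlaw : ∀ i, lawκ (κ i) (x₁ i) (x₂ i) (y₁ i) (y₂ i) (z₁ i) (z₂ i) = true := fun i =>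
    lawκ_of_counts _ _ _ _ _ _ _
      (fun hi α => two_missing_letters_dcoord κ hsub jΨ₁ jΨ₂ jΨ₃ hx hy hz hX hY hZ i hi α)
      (fun hi => two_missing_letters_cwcoord κ hsub jΨ₁ jΨ₂ jΨ₃ hx hy hz hX hY hZ i hi)
  obtain ⟨P₁, P₂, hne, h₁, h₂⟩ :=
    (hasPMκ_twoPMκ₂ (base₃_of_twoCw hB₃') N (by omega)).2 hN κ hκ hcw x₁ x₂ y₁ y₂ z₁ z₂ hx hy hz
      hlaw
  obtain ⟨f₁, j₁₁, j₁₂, j₁₃, i₁₁, i₁₂, i₁₃⟩ := isPMκ_iff.1 h₁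
  obtain ⟨f₂, j₂₁, j₂₂, j₂₃, i₂₁, i₂₂, i₂₃⟩ := isPMκ_iff.1 h₂
  exact no_comb_degeneration_of_two_matchings hne f₁ f₂ j₁₁ j₁₂ j₁₃ j₂₁ j₂₂ j₂₃
    (i₁₁.trans i₂₁.symm) (i₁₂.trans i₂₂.symm) (i₁₃.trans i₂₃.symm)
    ⟨Ψ, a, b, c, hzero, hone, jΨ₁, jΨ₂, jΨ₃, hX.trans i₁₁.symm, hY.trans i₁₂.symm,
      hZ.trans i₁₃.symm⟩

end Summit.MatrixMultiplication.MatrixMultiplication.Theorems.OutsiderSandwichToricCeilingPowTwoCw
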